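/-
Copyright (c) 2026 the pub-hodgecm-mathlib formalisation cell (harness21).  Prover seat hodgecm-mathlib-K2E3-p17 (g11), HCML Track B «K2-LIT» ∕ h413
(`stmt-HodgeConjecture-24833`), R90-TF section S3, (U3-F) brick P3b «the PLANTED POLYNOMIAL: prescribed middle residues, pinned positive constant term, all roots
real simple negative» (dealer R90-C12-plan (g2) RECONCILIATION 2026-09-05T00:40:15Z: P3a+P3b → K2E3-p17; memo `DEAL-S3-U3F-SPLIT.v2.md` row P3).  2026-09-05.
-/
import Summits.HodgeConjecture.HodgeConjecture.Theorems.R90S3SpreadModelRealRooted   -- ★ P3a: `exists_spreadModel`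
import Mathlib.Data.ZMod.Basic
import Mathlib.Algebra.Order.Floor.Ring
import HarnessLib

/-!
# R90-TF · S3 · THEOREMS — `R90S3PlantedPolynomial` ((U3-F) brick P3b): for every modulus `Q ≥ 1`, every degree `d ≥ 2`, every positive integer `c₀` and
# every family of middle residues mod `Q` there is a MONIC `g ∈ ℤ[X]` of degree `d` with those middle residues, constant term EXACTLY `c₀`, and ALL ROOTS
# REAL, SIMPLE and NEGATIVE

R90-TF section S3 (dealer R90-C12-plan (g2), memo v2 row P3; captain's census (C0)–(C3)); crux H413 (`stmt-HodgeConjecture-24833`, lane `--supports … --as helper`),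
route `HCCMUnconditional`.  THE PLANTING STEP of the ℚ-planted road behind `stub_R90_S3_auxGlobaliseField`: the assembly P8 takes `Q := p^N · 2^M · ℓ₁ · ℓ₂`,
assembles the middle residue targets by CRT (Mathlib `ZMod.chineseRemainder`) from the p-adic target `H = h·∏(X − cᵢ)` (precision `p^N`), the dyadic target
`∏ (X − eᵢ)` (precision `2^M`, classes `{1,5} mod 8`) and the two irreducibility targets of ★ P4′ (`R90S3IrreduciblePrescribedConstant`), and `c₀ := pᵃ`
(PINNED, census (C0)); this file returns the monic integer polynomial with those residues, that constant term, and `d` simple NEGATIVE real roots (so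
`F′ = ℚ(α)` is totally real and `α` totally negative — ★ P7 `R90S3CMOfTotNegRadicand`).  §2 gives the coefficientwise criterion by which P8 reads
«`g ≡ T (mod m)`» as the equality `g.map (ℤ → ℤ∕m) = T` needed by ★ P4 ∕ P4′ (`irreducible_map_rat_of_map_zmod_eq`, the two-prime sieve).  PURE MATHLIB + ★ P3a;
THEOREMS ONLY (no `def`, no `instance`, no notation, no named fact, no `sorry`); never imports `Cruxes/…/Lines`.

THE MATHEMATICS [folklore].  Put `B := Q`, `T := 4 + c₀ + 2^{d+1} d (Q+1)` and take the spread model `g_ℝ` of ★ P3a `exists_spreadModel` (monic, degree `d`,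
`g_ℝ(0) = c₀`).  For `0 < k < d` let `g_k ∈ ℤ` be the representative of the prescribed class mod `Q` in the real window `[ (g_ℝ)_k, (g_ℝ)_k + Q )`
(`g_k := r_k + Q·⌈((g_ℝ)_k − r_k)∕Q⌉`, `r_k ∈ [0,Q)` the canonical representative), so `|g_k − (g_ℝ)_k| ≤ Q = B`; put `g := X^d + Σ_{0<k<d} g_k X^k + c₀ ∈ ℤ[X]`.
Then `g` (read in `ℝ[X]`) is monic of degree `d` with the model's constant term and `B`-close middle coefficients, so by P3a it has `d` distinct real roots, all
negative, and every complex root is a negative real.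
* §1 `exists_int_rep_near` (an integer in a prescribed class mod `Q` within `Q` of a given real), `coeff_sum_C_mul_X_pow` (coefficients of `Σ C (c k) X^k`).
* §2 `map_eq_of_coeff_eq` (monic `g ∈ ℤ[X]` and monic `T ∈ (ℤ∕m)[X]` of degree `d` with the same constant term and congruent middle coefficients are equal after
  reduction), `coeff_castHom_of_dvd` (reading a residue mod `Q` modulo a divisor `m ∣ Q`).
* §3 **`exists_plantedPolynomial`** — the head: `∃ g : ℤ[X], g.Monic ∧ g.natDegree = d ∧ g.coeff 0 = c₀ ∧ (∀ k, 0 < k → k < d → (g.coeff k : ZMod Q) = r k) ∧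
  (g.map (Int.castRingHom ℝ)).roots.toFinset.card = d ∧ (∀ x ∈ (g.map (Int.castRingHom ℝ)).roots, x < 0) ∧
  ∀ z : ℂ, (g.map (Int.castRingHom ℂ)).IsRoot z → z.im = 0 ∧ z.re < 0`.

HONEST LABEL: HC_CM is proved only modulo the 7 printed citations (2 remaining named inputs: hLiu418 = stmt-HodgeConjecture-24832, h413 =
stmt-HodgeConjecture-24833) until rung 0 closes; elementary arithmetic for a sub-step of a GENUINE residual ((U3-F)); proves nothing printed; count-neutral.
References: [CasselsFrohlichANT1967] Ch. II §6 (approximation ∕ CRT); [Rogawski1990] §13.8 p. 216 (the auxiliary totally real field).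
-/

set_option autoImplicit false
-- the mandated namespace repeats the single-problem summit's segment (`HodgeConjecture.HodgeConjecture`)
set_option linter.dupNamespace false

noncomputable section

namespace Summit.HodgeConjecture.HodgeConjecture.R90.S3

open Polynomial Finset

/-! ## §1 Integers in a prescribed class near a real number; coefficients of an explicit sum -/

/-- **An integer in a prescribed residue class within `Q` of a real number**: for `Q ≥ 1`, `r ∈ ℤ∕Q` and `y ∈ ℝ` there is `n ∈ ℤ` with `n ≡ r (mod Q)` and
`0 ≤ n − y < Q` (namely `n := r₀ + Q·⌈(y − r₀)∕Q⌉`, `r₀` the canonical representative). [folklore] -/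
theorem exists_int_rep_near (Q : ℕ) [NeZero Q] (r : ZMod Q) (y : ℝ) : ∃ n : ℤ, (n : ZMod Q) = r ∧ 0 ≤ (n : ℝ) - y ∧ (n : ℝ) - y < Q := by
  have hQ : (0 : ℝ) < Q := by exact_mod_cast Nat.pos_of_ne_zero (NeZero.ne Q)
  refine ⟨(r.val : ℤ) + Q * ⌈(y - r.val) / (Q : ℝ)⌉, ?_, ?_, ?_⟩
  · push_cast
    rw [ZMod.natCast_zmod_val, ZMod.natCast_self, zero_mul, add_zero]
  · have h := Int.le_ceil ((y - r.val) / (Q : ℝ))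
    have h' : y - r.val ≤ Q * (⌈(y - r.val) / (Q : ℝ)⌉ : ℝ) := by
      rw [div_le_iff₀ hQ] at h; linarith
    push_cast
    linarith
  · have h := Int.ceil_lt_add_one ((y - r.val) / (Q : ℝ))
    have h' : Q * (⌈(y - r.val) / (Q : ℝ)⌉ : ℝ) < y - r.val + Q := by
      have := mul_lt_mul_of_pos_left h hQ
      rw [mul_add, mul_div_cancel₀ _ hQ.ne', mul_one] at this
      exact this
    push_cast
    linarith

/-- Coefficients of `Σ_{k ≤ d} C (c k) X^k`. [folklore] -/
theorem coeff_sum_C_mul_X_pow {R : Type*} [Semiring R] (d : ℕ) (c : ℕ → R) (k : ℕ) :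
    (∑ i ∈ range (d + 1), C (c i) * X ^ i : R[X]).coeff k = if k ≤ d then c k else 0 := by
  rw [finsetSum_coeff]
  simp only [coeff_C_mul_X_pow]
  rw [sum_ite_eq]
  by_cases hk : k ≤ d
  · rw [if_pos (mem_range.2 (Nat.lt_succ_of_le hk)), if_pos hk]
  · rw [if_neg (fun h => hk (Nat.le_of_lt_succ (mem_range.1 h))), if_neg hk]

/-- The explicit sum `Σ_{k ≤ d} C (c k) X^k` with `c d = 1` is monic of degree `d` (over a nontrivial semiring). [folklore] -/
theorem monic_natDegree_sum_C_mul_X_pow {R : Type*} [Semiring R] [Nontrivial R] (d : ℕ) (c : ℕ → R) (hcd : c d = 1) :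
    (∑ i ∈ range (d + 1), C (c i) * X ^ i : R[X]).Monic ∧ (∑ i ∈ range (d + 1), C (c i) * X ^ i : R[X]).natDegree = d := by
  have hle : (∑ i ∈ range (d + 1), C (c i) * X ^ i : R[X]).natDegree ≤ d :=
    natDegree_sum_le_of_forall_le _ _ fun i hi => (natDegree_C_mul_X_pow_le _ _).trans (Nat.le_of_lt_succ (mem_range.1 hi))
  have hcoeff : (∑ i ∈ range (d + 1), C (c i) * X ^ i : R[X]).coeff d = 1 := by rw [coeff_sum_C_mul_X_pow, if_pos le_rfl, hcd]
  have hdeg : (∑ i ∈ range (d + 1), C (c i) * X ^ i : R[X]).natDegree = d :=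
    le_antisymm hle (le_natDegree_of_ne_zero (by rw [hcoeff]; exact one_ne_zero))
  exact ⟨by rw [Monic, leadingCoeff, hdeg, hcoeff], hdeg⟩

/-! ## §2 Reading coefficient congruences as an equality of reductions -/

/-- **Coefficient congruences ⇒ equal reductions.**  If `g ∈ ℤ[X]` and `T ∈ (ℤ∕m)[X]` are both monic of degree `d`, have the same constant term after
reduction and congruent middle coefficients, then `g mod m = T` — the equality ★ P4 ∕ P4′ consume (`irreducible_map_rat_of_map_zmod_eq`, the two-prime sieve).
[folklore] -/
theorem map_eq_of_coeff_eq {m : ℕ} {g : ℤ[X]} {d : ℕ} (hg : g.Monic) (hgd : g.natDegree = d) (T : (ZMod m)[X]) (hT : T.Monic) (hTd : T.natDegree = d)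
    (h0 : ((g.coeff 0 : ℤ) : ZMod m) = T.coeff 0) (hmid : ∀ k, 0 < k → k < d → ((g.coeff k : ℤ) : ZMod m) = T.coeff k) :
    g.map (Int.castRingHom (ZMod m)) = T := by
  ext k
  rw [coeff_map, eq_intCast]
  rcases Nat.lt_trichotomy k d with hlt | heq | hgt
  · rcases Nat.eq_zero_or_pos k with rfl | hk
    · exact h0
    · exact hmid k hk hlt
  · subst heq
    have h1 : g.coeff g.natDegree = 1 := hg.coeff_natDegree
    have h2 : T.coeff T.natDegree = 1 := hT.coeff_natDegree
    rw [hgd] at h1; rw [hTd] at h2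
    rw [h1, h2, Int.cast_one]
  · rw [coeff_eq_zero_of_natDegree_lt (hgd ▸ hgt), coeff_eq_zero_of_natDegree_lt (hTd ▸ hgt), Int.cast_zero]

/-- **Reading a residue mod `Q` modulo a divisor `m ∣ Q`**: if `(n : ℤ∕Q) = r` then `(n : ℤ∕m) = ZMod.castHom _ r`. [folklore] -/
theorem intCast_eq_castHom_of_dvd {Q m : ℕ} (hm : m ∣ Q) {n : ℤ} {r : ZMod Q} (h : (n : ZMod Q) = r) :
    (n : ZMod m) = ZMod.castHom hm (ZMod m) r := by
  rw [← h, map_intCast]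

/-! ## §3 The planted polynomial -/

/-- **THE PLANTED POLYNOMIAL.**  For `d ≥ 2`, a modulus `Q ≥ 1`, middle residues `r k ∈ ℤ∕Q` (`0 < k < d`) and a positive integer `c₀`, there is a MONIC
`g ∈ ℤ[X]` of degree `d` with `g_k ≡ r_k (mod Q)` for `0 < k < d`, `g(0) = c₀` EXACTLY, `d` distinct real roots, every real root negative, and every complex
root a negative real number (`z.im = 0`, `z.re < 0`): the middle coefficients of the spread model of ★ P3a (`B := Q`, `T := 4 + c₀ + 2^{d+1} d (Q+1)`) rounded
into their classes. [folklore] -/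
theorem exists_plantedPolynomial {d : ℕ} (hd : 2 ≤ d) (Q : ℕ) [NeZero Q] (r : ℕ → ZMod Q) (c₀ : ℤ) (hc₀ : 0 < c₀) :
    ∃ g : ℤ[X], g.Monic ∧ g.natDegree = d ∧ g.coeff 0 = c₀ ∧ (∀ k, 0 < k → k < d → ((g.coeff k : ℤ) : ZMod Q) = r k) ∧
      (g.map (Int.castRingHom ℝ)).roots.toFinset.card = d ∧ (∀ x ∈ (g.map (Int.castRingHom ℝ)).roots, x < 0) ∧
        ∀ z : ℂ, (g.map (Int.castRingHom ℂ)).IsRoot z → z.im = 0 ∧ z.re < 0 := by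
  -- the spread model with `B := Q`, `c₀`, `T := 4 + c₀ + 2^{d+1} d (Q+1)`
  have hQ0 : (0 : ℝ) ≤ Q := Nat.cast_nonneg Q
  have hc₀R : (0 : ℝ) < (c₀ : ℝ) := by exact_mod_cast hc₀
  have hpow : (0 : ℝ) ≤ 2 ^ (d + 1) * d * ((Q : ℝ) + 1) := by positivity
  obtain ⟨gR, hgRm, hgRd, hgR0, hgR⟩ := exists_spreadModel hd (B := (Q : ℝ)) (c₀ := (c₀ : ℝ)) (T := 4 + c₀ + 2 ^ (d + 1) * d * ((Q : ℝ) + 1))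
    hQ0 hc₀R (by linarith) (by linarith) (by linarith)
  -- integer middle coefficients in the prescribed classes, `Q`-close to the model's
  choose n hn using fun k : ℕ => exists_int_rep_near Q (r k) (gR.coeff k)
  -- the integer polynomial
  let c : ℕ → ℤ := fun k => if k = d then 1 else if k = 0 then c₀ else n k
  have hcd : c d = 1 := by simp [c]
  have hc0 : c 0 = c₀ := by
    have : (0 : ℕ) ≠ d := by omega
    simp [c, this]
  have hcmid : ∀ k, 0 < k → k < d → c k = n k := fun k hk hkd => by
    have h1 : k ≠ d := by omega
    have h2 : k ≠ 0 := by omega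
    simp [c, h1, h2]
  set g : ℤ[X] := ∑ i ∈ range (d + 1), C (c i) * X ^ i with hgdef
  obtain ⟨hgm, hgd⟩ := monic_natDegree_sum_C_mul_X_pow d c hcd
  have hgcoeff : ∀ k, k ≤ d → g.coeff k = c k := fun k hk => by rw [hgdef, coeff_sum_C_mul_X_pow, if_pos hk]
  -- the real reading of `g`
  set gℝ : ℝ[X] := g.map (Int.castRingHom ℝ) with hgℝ
  have hgℝm : gℝ.Monic := hgm.map _
  have hgℝd : gℝ.natDegree = d := by rw [hgℝ, hgm.natDegree_map, hgd]
  have hgℝcoeff : ∀ k, gℝ.coeff k = (g.coeff k : ℝ) := fun k => by rw [hgℝ, coeff_map, eq_intCast]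
  have hgℝ0 : gℝ.coeff 0 = (c₀ : ℝ) := by rw [hgℝcoeff, hgcoeff 0 (by omega), hc0]
  have hgℝmid : ∀ k, 0 < k → k < d → |gℝ.coeff k - gR.coeff k| ≤ (Q : ℝ) := fun k hk hkd => by
    rw [hgℝcoeff, hgcoeff k hkd.le, hcmid k hk hkd]
    rw [abs_of_nonneg (hn k).2.1]
    exact (hn k).2.2.le
  obtain ⟨hcard, -, hneg, hcx⟩ := hgR gℝ hgℝm hgℝd hgℝ0 hgℝmid
  refine ⟨g, hgm, hgd, by rw [hgcoeff 0 (by omega), hc0], fun k hk hkd => by rw [hgcoeff k hkd.le, hcmid k hk hkd]; exact (hn k).1, hcard, hneg,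
    fun z hz => hcx z ?_⟩
  -- `g.map (ℤ → ℂ) = (g.map (ℤ → ℝ)).map (ℝ → ℂ)`
  have hmap : g.map (Int.castRingHom ℂ) = gℝ.map (algebraMap ℝ ℂ) := by
    rw [hgℝ, Polynomial.map_map, Subsingleton.elim ((algebraMap ℝ ℂ).comp (Int.castRingHom ℝ)) (Int.castRingHom ℂ)]
  rwa [hmap] at hz

end Summit.HodgeConjecture.HodgeConjecture.R90.S3

end
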